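import Literature.AlgebraicGeometry.HodgeTheory.ChernCharacterBetti
import Literature.AlgebraicGeometry.HodgeTheory.CupPreservesHodgeTypeOfDeRham
import Literature.AlgebraicGeometry.HodgeTheory.HardLefschetzComplexification
import Literature.AlgebraicGeometry.HodgeTheory.KaehlerClassHodgeType
import Literature.AlgebraicGeometry.HodgeTheory.HolomorphicBundleChernCharacterTopDegree
import HarnessLib

/-!
# Kähler classes on the summit carrier `H²(X(ℂ); ℂ)`

Family `hodge`, layer `Literature/AlgebraicGeometry/HodgeTheory`. For a smooth complex variety `X`
of dimension `n` (a `Motives.SchemeOver ℂ` with a Hodge model `A : HodgeModel n X`, i.e. an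
analytification `X^an = A.carrier → X(ℂ)`) a class `H ∈ H²(X(ℂ); ℂ) = complexBetti X 2` is a
**Kähler class** if it is the class of the Kähler form `ω_g` of a (smooth) Kähler metric `g` on
`X^an` ("The de Rham class of `ω` is called the Kähler class of the Kähler metric", Voisin I §3.1.3,
after Cor. 3.9; Def. 3.6 for Kähler metrics), read on the summit carrier through a real de Rham
comparison `e : H²_dR(X^an; ℝ) ≃ H²(X^an; ℝ)` (de Rham's theorem, natural and multiplicative:
`DeRhamIsoFamily.IsNatural/IsMultiplicative`, Warner Thm. 5.36 / 5.45), complexification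
`⊗ 1 : H²(X^an; ℝ) → H²(X^an; ℂ)` (`ofRealClass`, Voisin I §6.1.3 Cor. 6.12) and the comparison
homeomorphism `X^an → X(ℂ)` (`HodgeModel.pullback`, Serre GAGA §2):
`A^* H = e[ω_g] ⊗ 1`. This is VERBATIM the idiom of
`HodgeModel.existsUnique_pullback_eq_kaehlerClass` / `hasHardLefschetzProperty_of_pullback_eq_kaehlerClass`
(file `HardLefschetzComplexification`) and of `isOfHodgeType_one_one_of_pullback_eq_kaehlerClass`
(file `KaehlerClassHodgeType`), now given a name. Two predicates:

* `HodgeModel.IsKaehlerClassVia A e H` — Kähler with respect to a FIXED Hodge model `A` and real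
  de Rham family `e` (the "Kähler cone of `(A, e)`"): `∃ g Kähler, A^* H = e[ω_g] ⊗ 1`;
* `IsKaehlerClass n X H` — Kähler for SOME Hodge model and SOME natural multiplicative family:
  `∃ A hω g hg e, e.IsNatural ∧ e.IsMultiplicative ∧ A^* H = e[ω_g] ⊗ 1` (the requested spelling;
  `isKaehlerClass_iff` bridges the two).

## Results (all proved; no named fact is introduced)

* the cone of `(A, e)` is convex: `IsKaehlerClassVia.add` (`ω_g + ω_{g'}` is a closed positive real
  `(1,1)`-form, hence the Kähler form of a Kähler metric — Voisin I §3.1.1 Lemma 3.3, the tree's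
  `exists_isKaehler_kaehlerForm_eq_of_closed_positive_form`), `IsKaehlerClassVia.smul_of_pos`,
  `IsKaehlerClass.smul_of_pos`, `IsKaehlerClass.rat_smul_of_pos` (positive real / rational multiples);
* a Kähler class is REAL (`conj H = H`, `IsKaehlerClass.conjClass_eq`), of HODGE TYPE `(1, 1)`
  (`IsKaehlerClass.isOfHodgeType_one_one`, Voisin I §3.1.1 Lemma 3.3), NON-ZERO with all its
  POWERS `Hᵖ = cupPowTwo H p`, `1 ≤ p ≤ dim X` (`IsKaehlerClass.ne_zero`,
  `IsKaehlerClass.cupPowTwo_ne_zero`; Voisin I Cor. 3.9: `[ω]ᵖ ≠ 0`, i.e. `Vol > 0`; the comparison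
  is multiplicative on powers, `HodgeModel.cupPowTwo_ofRealClass_kaehlerClass`), and has the HARD
  LEFSCHETZ property in
  dimension `n` GRANTED the named fact `Motives.hasHardLefschetzProperty_kaehlerClass` (Voisin I
  Thm. 6.25, hodge.S14) for the models of `X` (`IsKaehlerClass.hasHardLefschetzProperty`) — so a
  Kähler class which is moreover rational and supported on a divisor is a polarisation class in the
  sense of `IsPolarizationClass` (file `MotivatedClasses`, not imported);
* the class of ANY Kähler metric is a Kähler class (`HodgeModel.kaehlerClassOf`,
  `HodgeModel.isKaehlerClassVia_kaehlerClassOf`), in particular the HYPERPLANE-TYPE class of a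
  projective embedding `ι : X ⟶ ℙᴺ` — the class of the restricted Fubini–Study form
  `θ = fubiniStudyPullbackForm`, which is the Kähler form of a Kähler metric
  (`HodgeModel.exists_isKaehler_kaehlerForm_eq_fubiniStudyPullbackForm`, Voisin I §3.3.2 Lemma 3.16
  and p. 77) — is Kähler (`HodgeModel.isKaehlerClassVia_of_pullback_eq_fubiniStudyPullbackForm`), and
  EVERY smooth projective `X` with a Hodge model carries a Kähler class, granted de Rham's theorem
  `exists_deRhamIsoFamily` for the model space (`exists_isKaehlerClass`).

## Why `∃` over Hodge models and comparison families (junk analysis)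

As for `IsOfHodgeType` (file `RationalHodgeClasses`): two Hodge models differ by a biholomorphism
over `X(ℂ)` (`IsAnalytification.unique`, GAGA §2), which transports Kähler metrics; two natural
multiplicative real de Rham families differ by a natural multiplicative automorphism of `H*(–; ℝ)`,
which in degree `2` is a POSITIVE scalar (it is a scalar `c₂` by Thom realisability, and
`c₂ = c₁² > 0` by multiplicativity on a `2`-torus) and positive scalars preserve Kähler forms. So the
predicate does not depend on the witnesses; this independence (requested item (v)) is NOT formalised
here — consequently sums of Kähler classes are only proved Kähler with respect to a common `(A, e)`
(`IsKaehlerClassVia.add`). If `X` has no Hodge model, no class is Kähler (safe failure: consumers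
assume Kähler classes). Also NOT here: pull-backs along closed immersions and external sums on
products (item (ii): needs comparison families across model spaces, cf. `HodgeTypePullback`);
rationality / integrality of the hyperplane class `[θ] = c₁(𝒪_X(1))` (Voisin I Thm. 7.10,
Lemma 7.29) and Kodaira's embedding theorem (Thm. 7.11: integral Kähler class ⇒ projective), i.e. the
reading "rational Kähler class = ℚ-ample class"; an `IsAmpleClass` through `CartierDivisor.IsAmple`.

## References

* [VoisinHodgeI2002] C. Voisin, Hodge Theory and Complex Algebraic Geometry I (CUP 2002), §3.1.1
  Lemma 3.3, §3.1.2 Def. 3.6, §3.1.3 Cor. 3.9 and the definition of the Kähler class after it,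
  §3.3.2 Lemma 3.16 and p. 77, §6.1.3 Cor. 6.12, Thm. 6.25, Rem. 6.27, §7.1.2, Def. 7.8, Thm. 7.10.
* [SerreGAGA1956] J.-P. Serre, Géométrie algébrique et géométrie analytique, Ann. Inst. Fourier 6
  (1956), §2.
* [WarnerGTM94] F. Warner, Foundations of Differentiable Manifolds and Lie Groups, Thm. 5.36 / 5.45.
* [HatcherAT2002] A. Hatcher, Algebraic Topology (CUP 2002), §3.1.
-/

noncomputable section

open scoped Manifold ContDiff
open CategoryTheory AlgebraicGeometry Bundle

namespace Literature.AlgebraicGeometry.HodgeTheory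

section HodgeTheory

open Literature.AlgebraicTopology.SingularHomology Literature.Geometry.Kaehler
open Literature.NumberTheory.Transcendental (DeRhamIsoFamily exists_deRhamIsoFamily WedgeFacts
  wedgeFacts_of_assoc)
open Literature.AlgebraicGeometry.Motives (kaehlerFormPow kaehlerFormPow_one
  kaehlerFormPow_deRhamCohomology_mk_ne_zero)
open Literature.AlgebraicGeometry.Motives.AnalytificationKaehler (fubiniStudyPullbackForm)

/-! ### Positive combinations of Kähler forms are Kähler forms -/

section Forms

variable {E : Type*} [NormedAddCommGroup E] [NormedSpace ℂ E]
  {M : Type*} [TopologicalSpace M] [ChartedSpace E M]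

/-- The Kähler form of a Hermitian metric is positive: `ω(v, Jv) = g(Jv, Jv) = g(v, v) > 0` for
`v ≠ 0` ("`ω(u, Iu) = g(u, u)`", Voisin I §3.1.1 after (3.1)). [cite: VoisinHodgeI2002, §3.1.1 Lemma 3.3] -/
theorem kaehlerForm_self_tangentJ_pos (g : RiemannianMetric (fun x : M ↦ TangentSpace 𝓘(ℝ, E) x))
    (hg : g.IsHermitian) (x : M) (v : TangentSpace 𝓘(ℝ, E) x) (hv : v ≠ 0) :
    0 < g.kaehlerForm x ![v, tangentJ E x v] := by
  rw [RiemannianMetric.kaehlerForm_apply_of_isHermitian g hg]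
  have hJv : tangentJ E x v ≠ 0 := fun h ↦ hv (by
    have h' := congrArg (tangentJ E x) h
    rwa [tangentJ_tangentJ, map_zero, neg_eq_zero] at h')
  exact g.pos x _ hJv

variable [FiniteDimensional ℂ E] [IsManifold 𝓘(ℂ, E) ω M] [IsManifold 𝓘(ℝ, E) ∞ M]

/-- **The sum of two Kähler forms is a Kähler form**: for smooth Kähler metrics `g, g'` there is a
smooth Kähler metric with Kähler form `ω_g + ω_{g'}` (namely `g + g'`; obtained here from
`exists_isKaehler_kaehlerForm_eq_of_closed_positive_form`: `ω_g + ω_{g'}` is smooth, closed,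
`J`-invariant and positive). Voisin I §3.1.1 Lemma 3.3 (real `(1,1)`-forms `ω` ↔ `J`-invariant
symmetric forms `g(u, v) = ω(u, Iv)`), §3.1.2 Def. 3.6. [cite: VoisinHodgeI2002, §3.1.1 Lemma 3.3 and §3.1.2 Def. 3.6] -/
theorem exists_isKaehler_kaehlerForm_eq_add
    (g g' : ContMDiffRiemannianMetric 𝓘(ℝ, E) ∞ E (fun x : M ↦ TangentSpace 𝓘(ℝ, E) x))
    (hg : g.toRiemannianMetric.IsKaehler) (hg' : g'.toRiemannianMetric.IsKaehler) :
    ∃ g'' : ContMDiffRiemannianMetric 𝓘(ℝ, E) ∞ E (fun x : M ↦ TangentSpace 𝓘(ℝ, E) x),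
      g''.toRiemannianMetric.IsKaehler ∧
        g''.toRiemannianMetric.kaehlerForm =
          g.toRiemannianMetric.kaehlerForm + g'.toRiemannianMetric.kaehlerForm := by
  have hω := isSmoothForm_kaehlerForm_of_isManifold_complex_holds (E := E) (M := M)
  refine exists_isKaehler_kaehlerForm_eq_of_closed_positive_form _ ((hω g).add (hω g')) ?_ ?_ ?_
  · change mextDeriv _ = 0
    rw [mextDeriv_add (hω g) (hω g'), hg.isClosedForm_kaehlerForm, hg'.isClosedForm_kaehlerForm,
      add_zero]
  · intro x v w
    change g.toRiemannianMetric.kaehlerForm x _ + g'.toRiemannianMetric.kaehlerForm x _ =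
      g.toRiemannianMetric.kaehlerForm x _ + g'.toRiemannianMetric.kaehlerForm x _
    rw [hg.isHermitian.kaehlerForm_tangentJ_tangentJ, hg'.isHermitian.kaehlerForm_tangentJ_tangentJ]
  · intro x v hv
    change 0 < g.toRiemannianMetric.kaehlerForm x _ + g'.toRiemannianMetric.kaehlerForm x _
    exact add_pos (kaehlerForm_self_tangentJ_pos _ hg.isHermitian x v hv)
      (kaehlerForm_self_tangentJ_pos _ hg'.isHermitian x v hv)

/-- **A positive multiple of a Kähler form is a Kähler form**: for a smooth Kähler metric `g` and
`c > 0` there is a smooth Kähler metric with Kähler form `c · ω_g` (namely `c · g`).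
[cite: VoisinHodgeI2002, §3.1.1 Lemma 3.3 and §3.1.2 Def. 3.6] -/
theorem exists_isKaehler_kaehlerForm_eq_smul {c : ℝ} (hc : 0 < c)
    (g : ContMDiffRiemannianMetric 𝓘(ℝ, E) ∞ E (fun x : M ↦ TangentSpace 𝓘(ℝ, E) x))
    (hg : g.toRiemannianMetric.IsKaehler) :
    ∃ g'' : ContMDiffRiemannianMetric 𝓘(ℝ, E) ∞ E (fun x : M ↦ TangentSpace 𝓘(ℝ, E) x),
      g''.toRiemannianMetric.IsKaehler ∧
        g''.toRiemannianMetric.kaehlerForm = c • g.toRiemannianMetric.kaehlerForm := by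
  have hω := isSmoothForm_kaehlerForm_of_isManifold_complex_holds (E := E) (M := M)
  refine exists_isKaehler_kaehlerForm_eq_of_closed_positive_form _ ((hω g).smul c) ?_ ?_ ?_
  · change mextDeriv _ = 0
    rw [mextDeriv_smul, hg.isClosedForm_kaehlerForm, smul_zero]
  · intro x v w
    change c • g.toRiemannianMetric.kaehlerForm x _ = c • g.toRiemannianMetric.kaehlerForm x _
    rw [hg.isHermitian.kaehlerForm_tangentJ_tangentJ]
  · intro x v hv
    change 0 < c • g.toRiemannianMetric.kaehlerForm x _
    exact smul_pos hc (kaehlerForm_self_tangentJ_pos _ hg.isHermitian x v hv)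

/-- Kähler classes add when Kähler forms do: `[ω_{g''}] = [ω_g] + [ω_{g'}]` if
`ω_{g''} = ω_g + ω_{g'}`. [cite: VoisinHodgeI2002, §3.1.3] -/
theorem kaehlerClass_eq_add_of_kaehlerForm_eq
    (hω : isSmoothForm_kaehlerForm_of_isManifold_complex (E := E) (M := M))
    {g g' g'' : ContMDiffRiemannianMetric 𝓘(ℝ, E) ∞ E (fun x : M ↦ TangentSpace 𝓘(ℝ, E) x)}
    (hg : g.toRiemannianMetric.IsKaehler) (hg' : g'.toRiemannianMetric.IsKaehler)
    (hg'' : g''.toRiemannianMetric.IsKaehler)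
    (h : g''.toRiemannianMetric.kaehlerForm =
      g.toRiemannianMetric.kaehlerForm + g'.toRiemannianMetric.kaehlerForm) :
    g''.kaehlerClass hω hg'' = g.kaehlerClass hω hg + g'.kaehlerClass hω hg' := by
  unfold ContMDiffRiemannianMetric.kaehlerClass
  rw [← map_add]
  congr 1
  exact Subtype.ext h

/-- Kähler classes scale when Kähler forms do: `[ω_{g''}] = c · [ω_g]` if `ω_{g''} = c · ω_g`.
[cite: VoisinHodgeI2002, §3.1.3] -/
theorem kaehlerClass_eq_smul_of_kaehlerForm_eq
    (hω : isSmoothForm_kaehlerForm_of_isManifold_complex (E := E) (M := M)) {c : ℝ}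
    {g g'' : ContMDiffRiemannianMetric 𝓘(ℝ, E) ∞ E (fun x : M ↦ TangentSpace 𝓘(ℝ, E) x)}
    (hg : g.toRiemannianMetric.IsKaehler) (hg'' : g''.toRiemannianMetric.IsKaehler)
    (h : g''.toRiemannianMetric.kaehlerForm = c • g.toRiemannianMetric.kaehlerForm) :
    g''.kaehlerClass hω hg'' = c • g.kaehlerClass hω hg := by
  unfold ContMDiffRiemannianMetric.kaehlerClass
  rw [← map_smul]
  congr 1
  exact Subtype.ext h

/-- **The Kähler class is non-zero** on a non-empty compact Kähler manifold of positive dimension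
(Voisin I Cor. 3.9 rephrased: "the de Rham class of `ωᵏ` is non-zero in `H²ᵏ(M)`", `k = 1`; the
tree's `kaehlerFormPow_deRhamCohomology_mk_ne_zero`). [cite: VoisinHodgeI2002, §3.1.3 Cor. 3.9] -/
theorem kaehlerClass_ne_zero [T2Space M] [CompactSpace M] [Nonempty M]
    (hω : isSmoothForm_kaehlerForm_of_isManifold_complex (E := E) (M := M))
    (g : ContMDiffRiemannianMetric 𝓘(ℝ, E) ∞ E (fun x : M ↦ TangentSpace 𝓘(ℝ, E) x))
    (hg : g.toRiemannianMetric.IsKaehler) (hE : 1 ≤ Module.finrank ℂ E) :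
    g.kaehlerClass hω hg ≠ 0 := by
  have hmem : g.toRiemannianMetric.kaehlerForm ∈ closedSmoothForms 𝓘(ℝ, E) M ℝ 2 :=
    (mem_closedSmoothForms_iff _).2 ⟨hω g, hg.isClosedForm_kaehlerForm⟩
  have hcl : kaehlerFormPow g.toRiemannianMetric 1 ∈ closedSmoothForms 𝓘(ℝ, E) M ℝ (2 * 1) := by
    rw [kaehlerFormPow_one]
    exact hmem
  have hne := kaehlerFormPow_deRhamCohomology_mk_ne_zero g hg hE hcl
  have heq : (⟨kaehlerFormPow g.toRiemannianMetric 1, hcl⟩ : closedSmoothForms 𝓘(ℝ, E) M ℝ (2 * 1)) =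
      ⟨g.toRiemannianMetric.kaehlerForm, hmem⟩ := by
    apply Subtype.ext
    change kaehlerFormPow g.toRiemannianMetric 1 = g.toRiemannianMetric.kaehlerForm
    rw [kaehlerFormPow_one]
    rfl
  rw [heq] at hne
  exact hne

end Forms

/-! ### Kähler classes with respect to a fixed Hodge model and de Rham comparison -/

variable {n : ℕ} {X : Motives.SchemeOver ℂ}

/-- **Kähler classes of a fixed Hodge model and comparison.** For a Hodge model `A` of `X`
(analytification `A.carrier → X(ℂ)`) and a real de Rham comparison family `e` over the manifolds
charted on `A.model`, the class `H ∈ H²(X(ℂ); ℂ)` is Kähler with respect to `(A, e)` if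
`A^* H = e[ω_g] ⊗ 1` for the Kähler class `[ω_g] ∈ H²_dR(A.carrier; ℝ)` of some smooth Kähler metric
`g` on `A.carrier` ("the de Rham class of `ω` is called the Kähler class of the Kähler metric").
The set of such `H` is the Kähler cone of `(A, e)` (convex: `IsKaehlerClassVia.add`,
`IsKaehlerClassVia.smul_of_pos`). [cite: VoisinHodgeI2002, §3.1.2 Def. 3.6 and §3.1.3 (after Cor. 3.9)] -/
def HodgeModel.IsKaehlerClassVia (A : HodgeModel n X) (e : DeRhamIsoFamily 𝓘(ℝ, A.model))
    (H : complexBetti X 2) : Prop :=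
  ∃ (g : ContMDiffRiemannianMetric 𝓘(ℝ, A.model) ∞ A.model
      (fun x : A.carrier ↦ TangentSpace 𝓘(ℝ, A.model) x)) (hg : g.toRiemannianMetric.IsKaehler),
    A.pullback 2 H = ofRealClass A.carrier 2 (e A.carrier 2
      (g.kaehlerClass (isSmoothForm_kaehlerForm_of_isManifold_complex_holds
        (E := A.model) (M := A.carrier)) hg))

namespace HodgeModel

variable (A : HodgeModel n X) (e : DeRhamIsoFamily 𝓘(ℝ, A.model))

/-- Introduction rule with an arbitrary witness `hω` of the (discharged) smoothness fact
`isSmoothForm_kaehlerForm_of_isManifold_complex` (all witnesses give the same class).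
[cite: VoisinHodgeI2002, §3.1.3] -/
theorem isKaehlerClassVia_of_pullback_eq_kaehlerClass
    (hω : isSmoothForm_kaehlerForm_of_isManifold_complex (E := A.model) (M := A.carrier))
    (g : ContMDiffRiemannianMetric 𝓘(ℝ, A.model) ∞ A.model
      (fun x : A.carrier ↦ TangentSpace 𝓘(ℝ, A.model) x))
    (hg : g.toRiemannianMetric.IsKaehler) {H : complexBetti X 2}
    (hH : A.pullback 2 H = ofRealClass A.carrier 2 (e A.carrier 2 (g.kaehlerClass hω hg))) :
    A.IsKaehlerClassVia e H :=
  ⟨g, hg, hH⟩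

/-- **The class on `X(ℂ)` of a Kähler metric** `g` on the Hodge model `A`, read through `e`: the
unique `H ∈ H²(X(ℂ); ℂ)` with `A^* H = e[ω_g] ⊗ 1` (`existsUnique_pullback_eq_kaehlerClass`: the
comparison `X^an → X(ℂ)` is a homeomorphism). [cite: VoisinHodgeI2002, §3.1.3 (after Cor. 3.9)]
[cite: SerreGAGA1956, §2] -/
def kaehlerClassOf (g : ContMDiffRiemannianMetric 𝓘(ℝ, A.model) ∞ A.model
      (fun x : A.carrier ↦ TangentSpace 𝓘(ℝ, A.model) x))
    (hg : g.toRiemannianMetric.IsKaehler) : complexBetti X 2 :=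
  (A.pullback_surjective 2 (ofRealClass A.carrier 2 (e A.carrier 2
    (g.kaehlerClass (isSmoothForm_kaehlerForm_of_isManifold_complex_holds
      (E := A.model) (M := A.carrier)) hg)))).choose

/-- Defining property of `kaehlerClassOf`: `A^* (kaehlerClassOf g) = e[ω_g] ⊗ 1`.
[cite: VoisinHodgeI2002, §3.1.3] -/
theorem pullback_kaehlerClassOf
    (hω : isSmoothForm_kaehlerForm_of_isManifold_complex (E := A.model) (M := A.carrier))
    (g : ContMDiffRiemannianMetric 𝓘(ℝ, A.model) ∞ A.model
      (fun x : A.carrier ↦ TangentSpace 𝓘(ℝ, A.model) x))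
    (hg : g.toRiemannianMetric.IsKaehler) :
    A.pullback 2 (A.kaehlerClassOf e g hg) = ofRealClass A.carrier 2 (e A.carrier 2 (g.kaehlerClass hω hg)) :=
  (A.pullback_surjective 2 (ofRealClass A.carrier 2 (e A.carrier 2
    (g.kaehlerClass (isSmoothForm_kaehlerForm_of_isManifold_complex_holds
      (E := A.model) (M := A.carrier)) hg)))).choose_spec

/-- Uniqueness: `A^* H = e[ω_g] ⊗ 1` iff `H = kaehlerClassOf g` (the pull-back to the model is
injective). [cite: SerreGAGA1956, §2] -/
theorem pullback_eq_kaehlerClass_iff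
    (hω : isSmoothForm_kaehlerForm_of_isManifold_complex (E := A.model) (M := A.carrier))
    (g : ContMDiffRiemannianMetric 𝓘(ℝ, A.model) ∞ A.model
      (fun x : A.carrier ↦ TangentSpace 𝓘(ℝ, A.model) x))
    (hg : g.toRiemannianMetric.IsKaehler) (H : complexBetti X 2) :
    A.pullback 2 H = ofRealClass A.carrier 2 (e A.carrier 2 (g.kaehlerClass hω hg)) ↔
      H = A.kaehlerClassOf e g hg := by
  refine ⟨fun h ↦ A.pullback_injective 2 (h.trans (A.pullback_kaehlerClassOf e hω g hg).symm), ?_⟩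
  rintro rfl
  exact A.pullback_kaehlerClassOf e hω g hg

/-- The class of a Kähler metric is a Kähler class of `(A, e)`. [cite: VoisinHodgeI2002, §3.1.3] -/
theorem isKaehlerClassVia_kaehlerClassOf
    (g : ContMDiffRiemannianMetric 𝓘(ℝ, A.model) ∞ A.model
      (fun x : A.carrier ↦ TangentSpace 𝓘(ℝ, A.model) x))
    (hg : g.toRiemannianMetric.IsKaehler) : A.IsKaehlerClassVia e (A.kaehlerClassOf e g hg) :=
  ⟨g, hg, A.pullback_kaehlerClassOf e _ g hg⟩

/-- A class is Kähler for `(A, e)` iff it is the class of some Kähler metric.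
[cite: VoisinHodgeI2002, §3.1.3] -/
theorem isKaehlerClassVia_iff_exists_eq_kaehlerClassOf (H : complexBetti X 2) :
    A.IsKaehlerClassVia e H ↔
      ∃ (g : ContMDiffRiemannianMetric 𝓘(ℝ, A.model) ∞ A.model
        (fun x : A.carrier ↦ TangentSpace 𝓘(ℝ, A.model) x)) (hg : g.toRiemannianMetric.IsKaehler),
        H = A.kaehlerClassOf e g hg := by
  refine ⟨fun ⟨g, hg, hH⟩ ↦ ⟨g, hg, (A.pullback_eq_kaehlerClass_iff e _ g hg H).1 hH⟩, ?_⟩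
  rintro ⟨g, hg, rfl⟩
  exact A.isKaehlerClassVia_kaehlerClassOf e g hg

variable {A e}

/-- **The Kähler cone of `(A, e)` is closed under sums**: `ω_g + ω_{g'}` is the Kähler form of a
Kähler metric (`exists_isKaehler_kaehlerForm_eq_add`), and `e`, `⊗ 1`, `A^*` are additive.
[cite: VoisinHodgeI2002, §3.1.1 Lemma 3.3 and §3.1.3] -/
theorem IsKaehlerClassVia.add {H H' : complexBetti X 2} (hH : A.IsKaehlerClassVia e H)
    (hH' : A.IsKaehlerClassVia e H') : A.IsKaehlerClassVia e (H + H') := by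
  obtain ⟨g, hg, hH⟩ := hH
  obtain ⟨g', hg', hH'⟩ := hH'
  obtain ⟨g'', hg'', hform⟩ := exists_isKaehler_kaehlerForm_eq_add g g' hg hg'
  refine ⟨g'', hg'', ?_⟩
  rw [map_add, hH, hH', ← map_add, ← map_add,
    kaehlerClass_eq_add_of_kaehlerForm_eq _ hg hg' hg'' hform]

/-- **The Kähler cone of `(A, e)` is closed under positive real multiples**: `c · ω_g` is the
Kähler form of a Kähler metric for `c > 0` (`exists_isKaehler_kaehlerForm_eq_smul`).
[cite: VoisinHodgeI2002, §3.1.1 Lemma 3.3 and §3.1.3] -/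
theorem IsKaehlerClassVia.smul_of_pos {H : complexBetti X 2} (hH : A.IsKaehlerClassVia e H) {c : ℝ}
    (hc : 0 < c) : A.IsKaehlerClassVia e ((c : ℂ) • H) := by
  obtain ⟨g, hg, hH⟩ := hH
  obtain ⟨g'', hg'', hform⟩ := exists_isKaehler_kaehlerForm_eq_smul hc g hg
  refine ⟨g'', hg'', ?_⟩
  rw [map_smul, hH, ← ofRealClass_smul, ← LinearEquiv.map_smul,
    kaehlerClass_eq_smul_of_kaehlerForm_eq _ hg hg'' hform]

/-- Positive rational multiples of Kähler classes of `(A, e)` are Kähler.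
[cite: VoisinHodgeI2002, §3.1.3 and §7.1.2] -/
theorem IsKaehlerClassVia.rat_smul_of_pos {H : complexBetti X 2} (hH : A.IsKaehlerClassVia e H)
    {q : ℚ} (hq : 0 < q) : A.IsKaehlerClassVia e ((q : ℂ) • H) := by
  have h := hH.smul_of_pos (c := (q : ℝ)) (by exact_mod_cast hq)
  rwa [Complex.ofReal_ratCast] at h

/-- **A Kähler class is real**: `conj H = H` (conjugation commutes with `A^*` and fixes `e[ω_g] ⊗ 1`;
`HodgeModel.conjClass_eq_of_pullback_eq_ofRealClass`). [cite: VoisinHodgeI2002, §6.1.3 Cor. 6.12] -/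
theorem IsKaehlerClassVia.conjClass_eq {H : complexBetti X 2} (hH : A.IsKaehlerClassVia e H) :
    conjClass (Motives.ComplexPoints X) 2 H = H := by
  obtain ⟨g, hg, hH⟩ := hH
  exact A.conjClass_eq_of_pullback_eq_ofRealClass hH

/-- **A Kähler class is of Hodge type `(1, 1)`** when `e` is natural (the Kähler form of a Hermitian
metric is a real `(1,1)`-form; `HodgeModel.isOfHodgeType_one_one_of_pullback_eq_kaehlerClass`).
[cite: VoisinHodgeI2002, §3.1.1 Lemma 3.3 and §7.1.2] -/
theorem IsKaehlerClassVia.isOfHodgeType_one_one {H : complexBetti X 2} (hH : A.IsKaehlerClassVia e H)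
    (he : e.IsNatural) : IsOfHodgeType n X 2 1 1 H := by
  obtain ⟨g, hg, hH⟩ := hH
  exact A.isOfHodgeType_one_one_of_pullback_eq_kaehlerClass _ g hg e he hH

/-- **A Kähler class has the hard Lefschetz property** in dimension `n` on `H*(X(ℂ); ℂ)`, for `X`
smooth projective of dimension `n` and `e` natural and multiplicative, GRANTED the hard Lefschetz
theorem for the compact Kähler manifold `A.carrier` (the named fact
`Motives.hasHardLefschetzProperty_kaehlerClass`, Voisin I Thm. 6.25 = hodge.S14; transported to
complex coefficients and to `X(ℂ)` by `HodgeModel.hasHardLefschetzProperty_of_pullback_eq_kaehlerClass`).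
[cite: VoisinHodgeI2002, Thm. 6.25 and Rem. 6.27] -/
theorem IsKaehlerClassVia.hasHardLefschetzProperty {H : complexBetti X 2}
    (hH : A.IsKaehlerClassVia e H) (hX : Motives.IsSmoothProjective n X)
    (hS14 : Motives.hasHardLefschetzProperty_kaehlerClass (E := A.model) (M := A.carrier))
    (he : e.IsNatural) (hem : e.IsMultiplicative) : HasHardLefschetzProperty H n := by
  obtain ⟨g, hg, hH⟩ := hH
  exact A.hasHardLefschetzProperty_of_pullback_eq_kaehlerClass hX hS14 _ g hg e he hem hH

/-- **A Kähler class is non-zero** when `X` is smooth projective of dimension `n ≥ 1` (`[ω_g] ≠ 0`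
on the non-empty compact Kähler manifold `A.carrier` of dimension `n`, Voisin I Cor. 3.9; `e`, `⊗ 1`
are injective and `A^*` is a bijection). [cite: VoisinHodgeI2002, §3.1.3 Cor. 3.9] -/
theorem IsKaehlerClassVia.ne_zero {H : complexBetti X 2} (hH : A.IsKaehlerClassVia e H)
    (hX : Motives.IsSmoothProjective n X) (hn : 1 ≤ n) : H ≠ 0 := by
  obtain ⟨g, hg, hH⟩ := hH
  haveI : Nonempty A.carrier := A.nonempty_carrier hX
  haveI : CompactSpace A.carrier := by
    haveI := Motives.ComplexPoints.compactSpace_of_isSmoothProjective hX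
    exact A.isAnalytification.homeomorph.symm.compactSpace
  have hne := kaehlerClass_ne_zero (isSmoothForm_kaehlerForm_of_isManifold_complex_holds
    (E := A.model) (M := A.carrier)) g hg (by rw [A.isAnalytification.finrank_eq]; exact hn)
  intro h0
  rw [h0, map_zero] at hH
  have h1 : e A.carrier 2 (g.kaehlerClass _ hg) = 0 :=
    ofRealClass_injective 2 (by rw [← hH, map_zero])
  exact hne ((LinearEquiv.map_eq_zero_iff _).1 h1)

/-! ### Cup powers of a Kähler class: `Hᵖ ≠ 0` for `1 ≤ p ≤ n` -/

variable (A e) in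
/-- **The comparison is multiplicative on powers of the Kähler class**: for `e` multiplicative
(wedge ↦ cup, Warner Thm. 5.45) and `p ≥ 1`, `(e[ω_g] ⊗ 1)ᵖ = e[ω_gᵖ] ⊗ 1` in `H²ᵖ(X^an; ℂ)`
(`cupPowTwo`, the tree's cup powers of a degree-`2` class; `⊗ 1` is multiplicative,
`ofRealClass_cupProduct`; `[ω^{p+1}] = [ωᵖ] ⌣ [ω]`, `deRhamCohomology.cup_mk_mk`).
[cite: WarnerGTM94, Thm. 5.45] [cite: VoisinHodgeI2002, §6.2.3] -/
theorem cupPowTwo_ofRealClass_kaehlerClass (hem : e.IsMultiplicative)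
    (hω : isSmoothForm_kaehlerForm_of_isManifold_complex (E := A.model) (M := A.carrier))
    (g : ContMDiffRiemannianMetric 𝓘(ℝ, A.model) ∞ A.model
      (fun x : A.carrier ↦ TangentSpace 𝓘(ℝ, A.model) x))
    (hg : g.toRiemannianMetric.IsKaehler) {p : ℕ} (hp : 1 ≤ p) :
    cupPowTwo (ofRealClass A.carrier 2 (e A.carrier 2 (g.kaehlerClass hω hg))) p =
      ofRealClass A.carrier (2 * p) (e A.carrier (2 * p) (deRhamCohomology.mk
        ⟨kaehlerFormPow g.toRiemannianMetric p, A.kaehlerFormPow_mem_closedSmoothForms g hg p⟩)) := by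
  haveI : WedgeFacts 𝓘(ℝ, A.model) A.carrier ℝ :=
    wedgeFacts_of_assoc 𝓘(ℝ, A.model) A.carrier ℝ (ContinuousAlternatingMap.WedgeAssoc_holds ℝ A.model ℝ)
  induction p, hp using Nat.le_induction with
  | base =>
    rw [cupPowTwo_one]
    have heq : (⟨kaehlerFormPow g.toRiemannianMetric 1, A.kaehlerFormPow_mem_closedSmoothForms g hg 1⟩ :
        closedSmoothForms 𝓘(ℝ, A.model) A.carrier ℝ (2 * 1)) =
        ⟨g.toRiemannianMetric.kaehlerForm,
          (mem_closedSmoothForms_iff _).2 ⟨hω g, hg.isClosedForm_kaehlerForm⟩⟩ := by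
      apply Subtype.ext
      change kaehlerFormPow g.toRiemannianMetric 1 = g.toRiemannianMetric.kaehlerForm
      rw [kaehlerFormPow_one]
      rfl
    rw [heq]
    rfl
  | succ p hp ih =>
    have hcup : deRhamCohomology.cup (two_mul_add_two p)
        (deRhamCohomology.mk
          ⟨kaehlerFormPow g.toRiemannianMetric p, A.kaehlerFormPow_mem_closedSmoothForms g hg p⟩)
        (g.kaehlerClass hω hg) =
        deRhamCohomology.mk ⟨kaehlerFormPow g.toRiemannianMetric (p + 1),
          A.kaehlerFormPow_mem_closedSmoothForms g hg (p + 1)⟩ := by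
      unfold ContMDiffRiemannianMetric.kaehlerClass
      rw [deRhamCohomology.cup_mk_mk]
      rfl
    rw [cupPowTwo_succ, ih, ← ofRealClass_cupProduct, ← hem, hcup]

/-- **The powers `Hᵖ`, `1 ≤ p ≤ n`, of a Kähler class of `(A, e)` are non-zero** in `H²ᵖ(X(ℂ); ℂ)`
(`X` smooth projective of dimension `n`, `e` multiplicative): "for every integer `k` between `1` and
`n`, the closed form `ωᵏ` is not exact" (Voisin I Cor. 3.9, by `∫ ωⁿ = Vol > 0` and Stokes; the
tree's `kaehlerFormPow_deRhamCohomology_mk_ne_zero`), transported by the injective `e`, `⊗ 1` and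
the multiplicative bijection `A^*` (`map_cupPowTwo`). [cite: VoisinHodgeI2002, §3.1.3 Cor. 3.9] -/
theorem IsKaehlerClassVia.cupPowTwo_ne_zero {H : complexBetti X 2} (hH : A.IsKaehlerClassVia e H)
    (hX : Motives.IsSmoothProjective n X) (hem : e.IsMultiplicative) {p : ℕ} (hp1 : 1 ≤ p)
    (hpn : p ≤ n) : cupPowTwo H p ≠ 0 := by
  obtain ⟨g, hg, hH⟩ := hH
  haveI : Nonempty A.carrier := A.nonempty_carrier hX
  haveI : CompactSpace A.carrier := by
    haveI := Motives.ComplexPoints.compactSpace_of_isSmoothProjective hX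
    exact A.isAnalytification.homeomorph.symm.compactSpace
  have hne := kaehlerFormPow_deRhamCohomology_mk_ne_zero g hg (k := p)
    (by rw [A.isAnalytification.finrank_eq]; exact hpn) (A.kaehlerFormPow_mem_closedSmoothForms g hg p)
  intro h0
  have h1 := map_cupPowTwo ⟨A.toComplexPoints, A.isAnalytification.isHomeomorph.continuous⟩ H p
  rw [h0, map_zero] at h1
  change 0 = cupPowTwo (A.pullback 2 H) p at h1
  rw [hH, A.cupPowTwo_ofRealClass_kaehlerClass e hem _ g hg hp1] at h1
  have h2 : e A.carrier (2 * p) (deRhamCohomology.mk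
      ⟨kaehlerFormPow g.toRiemannianMetric p, A.kaehlerFormPow_mem_closedSmoothForms g hg p⟩) = 0 :=
    ofRealClass_injective (2 * p) (by rw [← h1, map_zero])
  exact hne ((LinearEquiv.map_eq_zero_iff _).1 h2)

/-! ### The hyperplane-type class of a projective embedding is Kähler -/

/-- The restricted Fubini–Study form `θ` of a projective embedding `ι : X ⟶ ℙᴺ`, on a Hodge
model `A` of `X`, is a closed smooth real `2`-form
(`isSmoothForm_fubiniStudyPullbackForm`, `isClosedForm_fubiniStudyPullbackForm`).
[cite: VoisinHodgeI2002, §3.3.2 Lemma 3.16] -/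
theorem fubiniStudyPullbackForm_mem_closedSmoothForms (A : HodgeModel n X) {N : ℕ}
    (ι : X ⟶ Motives.projectiveSpace N ℂ) [IsClosedImmersion ι.left] :
    fubiniStudyPullbackForm A.model ι A.toComplexPoints ∈ closedSmoothForms 𝓘(ℝ, A.model) A.carrier ℝ 2 :=
  (mem_closedSmoothForms_iff _).2
    ⟨Motives.AnalytificationKaehler.isSmoothForm_fubiniStudyPullbackForm A.isAnalytification,
      Motives.AnalytificationKaehler.isClosedForm_fubiniStudyPullbackForm A.isAnalytification⟩

/-- **The hyperplane-type class is Kähler.** For `X` smooth projective with a closed immersion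
`ι : X ⟶ ℙᴺ`, a Hodge model `A` and a real de Rham family `e`: a class `H ∈ H²(X(ℂ); ℂ)` with
`A^* H = e[θ] ⊗ 1`, `θ` the restricted Fubini–Study form of `ι` (whose class is the hyperplane class
`c₁(𝒪_X(1)) = [X ∩ H]` up to the normalisation of `θ`, Voisin I Thm. 7.10 / §11.1.2 — an
identification not made here), is a Kähler class of `(A, e)`: `θ` is the Kähler form of a Kähler
metric (`exists_isKaehler_kaehlerForm_eq_fubiniStudyPullbackForm`, Voisin I §3.3.2 Lemma 3.16 and
p. 77: "every complex projective manifold is Kähler"). [cite: VoisinHodgeI2002, §3.3.2 Lemma 3.16 and p. 77] -/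
theorem isKaehlerClassVia_of_pullback_eq_fubiniStudyPullbackForm (A : HodgeModel n X)
    (e : DeRhamIsoFamily 𝓘(ℝ, A.model)) (hX : Motives.IsSmoothProjective n X) {N : ℕ}
    (ι : X ⟶ Motives.projectiveSpace N ℂ) [IsClosedImmersion ι.left]
    (hθ : fubiniStudyPullbackForm A.model ι A.toComplexPoints ∈ closedSmoothForms 𝓘(ℝ, A.model) A.carrier ℝ 2)
    {H : complexBetti X 2}
    (hH : A.pullback 2 H = ofRealClass A.carrier 2 (e A.carrier 2
      (deRhamCohomology.mk ⟨fubiniStudyPullbackForm A.model ι A.toComplexPoints, hθ⟩))) :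
    A.IsKaehlerClassVia e H := by
  obtain ⟨g, hg, hform⟩ := A.exists_isKaehler_kaehlerForm_eq_fubiniStudyPullbackForm hX ι
  refine ⟨g, hg, ?_⟩
  rw [hH]
  congr 3
  exact Subtype.ext hform.symm

/-- Hence **every smooth projective variety carries a Kähler class for `(A, e)`**, for every Hodge
model `A` and real de Rham family `e`: the hyperplane-type class of any projective embedding.
[cite: VoisinHodgeI2002, §3.3.2 p. 77] -/
theorem exists_isKaehlerClassVia (A : HodgeModel n X) (e : DeRhamIsoFamily 𝓘(ℝ, A.model))
    (hX : Motives.IsSmoothProjective n X) : ∃ H : complexBetti X 2, A.IsKaehlerClassVia e H := by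
  obtain ⟨N, ι, hι⟩ := hX.isProjectiveOver
  have hθ := A.fubiniStudyPullbackForm_mem_closedSmoothForms ι
  obtain ⟨H, hH⟩ := A.pullback_surjective 2 (ofRealClass A.carrier 2 (e A.carrier 2
    (deRhamCohomology.mk ⟨fubiniStudyPullbackForm A.model ι A.toComplexPoints, hθ⟩)))
  exact ⟨H, A.isKaehlerClassVia_of_pullback_eq_fubiniStudyPullbackForm e hX ι hθ hH⟩

end HodgeModel

/-! ### Kähler classes -/

/-- **Kähler classes on the summit carrier.** A class `H ∈ H²(X(ℂ); ℂ)` of the `n`-dimensional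
smooth complex variety `X` is a KÄHLER CLASS if, for some Hodge model `A` of `X` (analytification
`X^an = A.carrier → X(ℂ)`), some smooth Kähler metric `g` on `X^an` and some natural, multiplicative
real de Rham comparison family `e` (de Rham's theorem, `exists_deRhamIsoFamily`), `H` pulls back to
the complexified comparison image of the Kähler class `[ω_g] ∈ H²_dR(X^an; ℝ)`:
`A^* H = e[ω_g] ⊗ 1` ("the de Rham class of `ω` is called the Kähler class of the Kähler metric",
Voisin I §3.1.3; "a class `[ω] ∈ H²(X, ℝ)` which is the cohomology class of a Kähler form", §7.1.2).
Verbatim the hypothesis block of `HodgeModel.existsUnique_pullback_eq_kaehlerClass` /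
`hasHardLefschetzProperty_of_pullback_eq_kaehlerClass`; `hω` ranges over the witnesses of the
discharged smoothness fact `isSmoothForm_kaehlerForm_of_isManifold_complex` (all give the same
class). Independent of the witnesses `A`, `e` up to the unformalised rigidity explained in the module
docstring; equivalently `∃ A e, e.IsNatural ∧ e.IsMultiplicative ∧ A.IsKaehlerClassVia e H`
(`isKaehlerClass_iff`). [cite: VoisinHodgeI2002, §3.1.2 Def. 3.6, §3.1.3 (after Cor. 3.9) and §7.1.2] -/
def IsKaehlerClass (n : ℕ) (X : Motives.SchemeOver ℂ) (H : complexBetti X 2) : Prop :=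
  ∃ (A : HodgeModel n X)
    (hω : isSmoothForm_kaehlerForm_of_isManifold_complex (E := A.model) (M := A.carrier))
    (g : ContMDiffRiemannianMetric 𝓘(ℝ, A.model) ∞ A.model
      (fun x : A.carrier ↦ TangentSpace 𝓘(ℝ, A.model) x))
    (hg : g.toRiemannianMetric.IsKaehler) (e : DeRhamIsoFamily 𝓘(ℝ, A.model)),
    e.IsNatural ∧ e.IsMultiplicative ∧
      A.pullback 2 H = ofRealClass A.carrier 2 (e A.carrier 2 (g.kaehlerClass hω hg))

/-- `IsKaehlerClass` in terms of the cone of a model: `H` is Kähler iff it is Kähler for some Hodge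
model and some natural multiplicative real de Rham family. [cite: VoisinHodgeI2002, §3.1.3] -/
theorem isKaehlerClass_iff (H : complexBetti X 2) :
    IsKaehlerClass n X H ↔ ∃ (A : HodgeModel n X) (e : DeRhamIsoFamily 𝓘(ℝ, A.model)),
      e.IsNatural ∧ e.IsMultiplicative ∧ A.IsKaehlerClassVia e H := by
  constructor
  · rintro ⟨A, hω, g, hg, e, he, hem, hH⟩
    exact ⟨A, e, he, hem, g, hg, hH⟩
  · rintro ⟨A, e, he, hem, g, hg, hH⟩
    exact ⟨A, _, g, hg, e, he, hem, hH⟩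

/-- A Kähler class of `(A, e)` with `e` natural and multiplicative is a Kähler class.
[cite: VoisinHodgeI2002, §3.1.3] -/
theorem HodgeModel.IsKaehlerClassVia.isKaehlerClass {A : HodgeModel n X}
    {e : DeRhamIsoFamily 𝓘(ℝ, A.model)} {H : complexBetti X 2} (hH : A.IsKaehlerClassVia e H)
    (he : e.IsNatural) (hem : e.IsMultiplicative) : IsKaehlerClass n X H :=
  (isKaehlerClass_iff H).2 ⟨A, e, he, hem, hH⟩

namespace IsKaehlerClass

variable {H : complexBetti X 2}

/-- **Positive real multiples of Kähler classes are Kähler.** [cite: VoisinHodgeI2002, §3.1.3 and §7.1.2] -/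
theorem smul_of_pos (hH : IsKaehlerClass n X H) {c : ℝ} (hc : 0 < c) :
    IsKaehlerClass n X ((c : ℂ) • H) := by
  obtain ⟨A, e, he, hem, hH⟩ := (isKaehlerClass_iff H).1 hH
  exact (hH.smul_of_pos hc).isKaehlerClass he hem

/-- **Positive rational multiples of Kähler classes are Kähler.** [cite: VoisinHodgeI2002, §3.1.3 and §7.1.2] -/
theorem rat_smul_of_pos (hH : IsKaehlerClass n X H) {q : ℚ} (hq : 0 < q) :
    IsKaehlerClass n X ((q : ℂ) • H) := by
  obtain ⟨A, e, he, hem, hH⟩ := (isKaehlerClass_iff H).1 hH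
  exact (hH.rat_smul_of_pos hq).isKaehlerClass he hem

/-- Sums with a Kähler class of the SAME model and family are Kähler (the general statement needs
the independence of the predicate from `(A, e)`, module docstring). [cite: VoisinHodgeI2002, §3.1.3] -/
theorem add_of_isKaehlerClassVia {A : HodgeModel n X} {e : DeRhamIsoFamily 𝓘(ℝ, A.model)}
    {H H' : complexBetti X 2} (hH : A.IsKaehlerClassVia e H) (hH' : A.IsKaehlerClassVia e H')
    (he : e.IsNatural) (hem : e.IsMultiplicative) : IsKaehlerClass n X (H + H') :=
  (hH.add hH').isKaehlerClass he hem

/-- **A Kähler class is real**: `conj H = H`. [cite: VoisinHodgeI2002, §6.1.3 Cor. 6.12 and §7.1.2] -/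
theorem conjClass_eq (hH : IsKaehlerClass n X H) : conjClass (Motives.ComplexPoints X) 2 H = H := by
  obtain ⟨A, e, -, -, hH⟩ := (isKaehlerClass_iff H).1 hH
  exact hH.conjClass_eq

/-- **A Kähler class is of Hodge type `(1, 1)`.** [cite: VoisinHodgeI2002, §3.1.1 Lemma 3.3 and §7.1.2] -/
theorem isOfHodgeType_one_one (hH : IsKaehlerClass n X H) : IsOfHodgeType n X 2 1 1 H := by
  obtain ⟨A, e, he, -, hH⟩ := (isKaehlerClass_iff H).1 hH
  exact hH.isOfHodgeType_one_one he

/-- **A Kähler class is non-zero** (`X` smooth projective of dimension `n ≥ 1`).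
[cite: VoisinHodgeI2002, §3.1.3 Cor. 3.9] -/
theorem ne_zero (hH : IsKaehlerClass n X H) (hX : Motives.IsSmoothProjective n X) (hn : 1 ≤ n) :
    H ≠ 0 := by
  obtain ⟨A, e, -, -, hH⟩ := (isKaehlerClass_iff H).1 hH
  exact hH.ne_zero hX hn

/-- **The powers `Hᵖ`, `1 ≤ p ≤ n`, of a Kähler class are non-zero** (`X` smooth projective of
dimension `n`; Voisin I Cor. 3.9 on the summit carrier). [cite: VoisinHodgeI2002, §3.1.3 Cor. 3.9] -/
theorem cupPowTwo_ne_zero (hH : IsKaehlerClass n X H) (hX : Motives.IsSmoothProjective n X) {p : ℕ}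
    (hp1 : 1 ≤ p) (hpn : p ≤ n) : cupPowTwo H p ≠ 0 := by
  obtain ⟨A, e, -, hem, hH⟩ := (isKaehlerClass_iff H).1 hH
  exact hH.cupPowTwo_ne_zero hX hem hp1 hpn

/-- **A Kähler class has the hard Lefschetz property** in dimension `n` on `H*(X(ℂ); ℂ)` (`X`
smooth projective of dimension `n`), GRANTED the hard Lefschetz theorem
`Motives.hasHardLefschetzProperty_kaehlerClass` (Voisin I Thm. 6.25, hodge.S14) for the Hodge models
of `X`: `Lʲ : Hᵏ(X(ℂ); ℂ) → H^{k+2j}(X(ℂ); ℂ)` is bijective for `k + j = n`. With `IsRationalClass H`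
and `H ∈ algebraicClasses X 1` this is the datum `IsPolarizationClass n X H` of `MotivatedClasses`.
[cite: VoisinHodgeI2002, Thm. 6.25, Rem. 6.27 and §7.1.2] -/
theorem hasHardLefschetzProperty (hH : IsKaehlerClass n X H) (hX : Motives.IsSmoothProjective n X)
    (hS14 : ∀ A : HodgeModel n X,
      Motives.hasHardLefschetzProperty_kaehlerClass (E := A.model) (M := A.carrier)) :
    HasHardLefschetzProperty H n := by
  obtain ⟨A, e, he, hem, hH⟩ := (isKaehlerClass_iff H).1 hH
  exact hH.hasHardLefschetzProperty hX (hS14 A) he hem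

end IsKaehlerClass

/-- **Every smooth projective variety carries a Kähler class** (given a Hodge model `A` — a theorem
for `X` smooth projective, the tree's `nonempty_hodgeModel` — and de Rham's theorem
`exists_deRhamIsoFamily` for the manifolds charted on `A.model`): the hyperplane-type class of a
projective embedding (`HodgeModel.exists_isKaehlerClassVia`). [cite: VoisinHodgeI2002, §3.3.2 p. 77 and §7.1.2] -/
theorem exists_isKaehlerClass (hX : Motives.IsSmoothProjective n X) (A : HodgeModel n X)
    (hdR : exists_deRhamIsoFamily 𝓘(ℝ, A.model)) : ∃ H : complexBetti X 2, IsKaehlerClass n X H := by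
  obtain ⟨e, he, hem, -⟩ := hdR
  obtain ⟨H, hH⟩ := A.exists_isKaehlerClassVia e hX
  exact ⟨H, hH.isKaehlerClass he hem⟩

end HodgeTheory

end Literature.AlgebraicGeometry.HodgeTheory

end
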